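import Summits.QuantumFields.YangMills.Theorems.ColdStartUniversalityLatticeLangevinRiemannW1ColdStartMixing
import Summits.QuantumFields.YangMills.Theorems.ColdStartUniversalityLatticeLangevinRiemannContractionLinkLipschitz
import Literature.Geometry.Riemannian.MetricFlowConcentration
import HarnessLib

/-!
# The `W₁` contraction of the `SU(2)` lattice Langevin dynamics in three further currencies: link-Lipschitz profiles, Frobenius distance, and
# couplings of arbitrary initial laws — `|∫F d(κ_t∘ν) − ∫F d(κ_t∘ν')| ≤ e^(−(1−12|β'|)t)·Lip_(ρ_L)(F)·∫ρ_L dπ` for every coupling `π` of `ν, ν'`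

Seat `ym-line-csu-p1` (g41), route `ColdStartUniversality` of `Summits/QuantumFields/YangMills`, helper file G57 (`--supports stmt-QuantumFields-24809`).
Corollaries of G54 (`wilson_riemannLipschitz_contraction_allLipschitz`, every `ρ_L`-Lipschitz observable, no smoothness):

* ★ `continuous_torusRiemannDistSq_two` — `(Q,Q') ↦ ρ_L(Q,Q')²` is jointly continuous;
* ★★ `wilson_linkLipschitz_contraction_allLipschitz` — for EVERY `F` with a link-Lipschitz profile `ℓ` (`|F(y) − F(y')| ≤ ℓ_e‖y_e − y'_e‖_F` when
  `y, y'` agree off `e`): `|κ_tF(Q) − κ_tF(Q')| ≤ e^(−(1−12|β'|)t)·√(Σ_e ℓ_e²)·ρ_L(Q,Q')` (G47 needed a `C⁵` cylinder function);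
* ★★ `wilson_frobLipschitz_contraction_allLipschitz` — Frobenius in, Frobenius out: if `|F(Q') − F(Q)| ≤ K·√(Σ_e‖Q'_e − Q_e‖_F²)` then
  `|κ_tF(Q) − κ_tF(Q')| ≤ e^(−(1−12|β'|)t)·K·(π/2)·√(Σ_e‖Q'_e − Q_e‖_F²)`;
* ★★★ `wilson_W1_contraction_of_coupling` — for probability laws `ν, ν'` of starts and EVERY coupling `π` of `(ν, ν')`:
  `|∫F d(κ_t ∘ₘ ν) − ∫F d(κ_t ∘ₘ ν')| ≤ e^(−(1−12|β'|)t)·L_F·∫ ρ_L(Q,Q') dπ(Q,Q')` — the Kantorovich side of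
  `W₁(νP_t, ν'P_t) ≤ e^(−(1−12|β'|)t)·W₁(ν, ν')`;
* ★★ `wilson_W1_contraction_szzWasserstein` — the same against the tree's coupling infimum `szzWassersteinSq ρ_L ν ν'` (which, for the
  un-squared cost `ρ_L`, IS `W₁(ν,ν')`): `ofReal |…| ≤ ofReal(e^(−(1−12|β'|)t)·L_F) · szzWassersteinSq ρ_L ν ν'`.

THEOREMS ONLY, no definition, no sorry.  HONEST FRAMING: fixed cut-off, `|β'| < 1/12`; the dual (Lipschitz) side of `W₁` only — no optimal coupling
is constructed and SZZ's `W₂` statement (4.5) is NOT discharged; nothing `K`-uniform along the route's scaling; `UniformColdStartMixing` (24809, ASIDE)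
not restated; no crux, rung or summit statement is proved; the Yang–Mills mass gap is NOT proved.
-/

set_option autoImplicit false

noncomputable section

namespace Summit.QuantumFields.YangMills.Theorems.ColdStartUniversality

open MeasureTheory ProbabilityTheory Matrix Complex Finset Filter Topology Set
open scoped ComplexConjugate BigOperators Real NNReal ENNReal
open Literature.MathematicalPhysics.QuantumFieldTheory
open Literature.MathematicalPhysics.QuantumLattice (fundamentalRep fundamentalLatticeRep continuous_fundamentalRep fundamentalRep_apply fundamentalLatticeRep_N)
open Literature.Geometry.Riemannian (IsCoupling)

variable {L : ℕ} [NeZero L]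

/-! ## §1. Joint continuity of `ρ_L²` -/

/-- `(g, h) ↦ ρ(g, h)` is jointly continuous on `SU(2) × SU(2)` (closed form, G40). [cite: GallotHulinLafontaine2004, 2.91] -/
theorem continuous_riemannDist_two :
    Continuous fun p : Matrix.specialUnitaryGroup (Fin 2) ℂ × Matrix.specialUnitaryGroup (Fin 2) ℂ => (fundamentalLatticeRep 2).riemannDist p.1 p.2 := by
  have hfun : (fun p : Matrix.specialUnitaryGroup (Fin 2) ℂ × Matrix.specialUnitaryGroup (Fin 2) ℂ => (fundamentalLatticeRep 2).riemannDist p.1 p.2) =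
      fun p => Real.sqrt 2 * Real.arccos ((((p.2 : Matrix (Fin 2) (Fin 2) ℂ)) * star (p.1 : Matrix (Fin 2) (Fin 2) ℂ)).trace.re / 2) :=
    funext fun p => riemannDist_two_eq p.1 p.2
  rw [hfun]
  refine continuous_const.mul (Real.continuous_arccos.comp ?_)
  refine (Complex.continuous_re.comp ?_).div_const _
  have h1 : Continuous fun p : Matrix.specialUnitaryGroup (Fin 2) ℂ × Matrix.specialUnitaryGroup (Fin 2) ℂ => (p.2 : Matrix (Fin 2) (Fin 2) ℂ) :=
    continuous_subtype_val.comp continuous_snd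
  have h2 : Continuous fun p : Matrix.specialUnitaryGroup (Fin 2) ℂ × Matrix.specialUnitaryGroup (Fin 2) ℂ => star (p.1 : Matrix (Fin 2) (Fin 2) ℂ) :=
    (continuous_subtype_val.comp continuous_fst).star
  exact (h1.matrix_mul h2).matrix_trace

/-- ★ `(Q, Q') ↦ ρ_L(Q, Q')²` is jointly continuous on `SU(2)^E × SU(2)^E`. [cite: ShenZhuZhu2022, §4.1] -/
theorem continuous_torusRiemannDistSq_two :
    Continuous fun p : GaugeConfig 3 L (Matrix.specialUnitaryGroup (Fin 2) ℂ) × GaugeConfig 3 L (Matrix.specialUnitaryGroup (Fin 2) ℂ) =>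
      torusRiemannDistSq (fundamentalLatticeRep 2) p.1 p.2 := by
  unfold torusRiemannDistSq
  refine continuous_finsetSum _ fun e _ => ?_
  have he : Continuous fun p : GaugeConfig 3 L (Matrix.specialUnitaryGroup (Fin 2) ℂ) × GaugeConfig 3 L (Matrix.specialUnitaryGroup (Fin 2) ℂ) =>
      ((p.1 e, p.2 e) : Matrix.specialUnitaryGroup (Fin 2) ℂ × Matrix.specialUnitaryGroup (Fin 2) ℂ) :=
    ((continuous_apply e).comp continuous_fst).prodMk ((continuous_apply e).comp continuous_snd)
  have hρ := continuous_riemannDist_two.comp he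
  exact hρ.pow 2

/-! ## §2. Link-Lipschitz and Frobenius currencies -/

/-- ★★ **Contraction for every observable with a link-Lipschitz profile** (no smoothness): if `|F(y) − F(y')| ≤ ℓ_e‖y_e − y'_e‖_F` whenever `y, y'`
agree off `e`, then `|κ_tF(Q) − κ_tF(Q')| ≤ e^(−(1−12|β'|)t)·√(Σ_e ℓ_e²)·ρ_L(Q,Q')`. [cite: ShenZhuZhu2022, Theorem 4.2 (4.5)] -/
theorem wilson_linkLipschitz_contraction_allLipschitz (L : ℕ) [NeZero L]
    {F : GaugeConfig 3 L (Matrix.specialUnitaryGroup (Fin 2) ℂ) → ℝ} {ℓ : Edge 3 L → ℝ}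
    (hF : ∀ (e : Edge 3 L) (y y' : GaugeConfig 3 L (Matrix.specialUnitaryGroup (Fin 2) ℂ)), (∀ f, f ≠ e → y f = y' f) →
      |F y - F y'| ≤ ℓ e * frobNorm ((y e : Matrix (Fin 2) (Fin 2) ℂ) - (y' e : Matrix (Fin 2) (Fin 2) ℂ)))
    (Q Q' : GaugeConfig 3 L (Matrix.specialUnitaryGroup (Fin 2) ℂ)) (t : ℝ≥0) (β' : ℝ) (hβ : |β'| < 1 / 12)
    (κ : ℝ≥0 → Kernel (GaugeConfig 3 L (Matrix.specialUnitaryGroup (Fin 2) ℂ))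
      (GaugeConfig 3 L (Matrix.specialUnitaryGroup (Fin 2) ℂ))) [∀ t, IsMarkovKernel (κ t)]
    (hreal : ∀ (t : ℝ≥0) (x : GaugeConfig 3 L (Matrix.specialUnitaryGroup (Fin 2) ℂ))
        (Ω : Type) [MeasurableSpace Ω] (P : Measure Ω) [IsProbabilityMeasure P]
        (W : ℝ≥0 → Ω → (Edge 3 L × NoiseIdx 2 → ℝ)) (hW : IsFlatBrownian W P)
        (U : ℝ≥0 → Ω → GaugeConfig 3 L (Matrix.specialUnitaryGroup (Fin 2) ℂ)),
        (∀ ω, U 0 ω = x) →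
        (latticeLangevinDynamics (fundamentalLatticeRep 2) β').IsSolution (fundamentalRep (Fin 2))
          hW.natFiltration P W U →
        κ t x = P.map (U t))
    :
    |∫ y, F y ∂(κ t Q) - ∫ y, F y ∂(κ t Q')| ≤
      Real.exp (-((1 - 12 * |β'|) * (t : ℝ))) * Real.sqrt (∑ e : Edge 3 L, ℓ e ^ 2) * Real.sqrt (torusRiemannDistSq (fundamentalLatticeRep 2) Q Q') :=
  wilson_riemannLipschitz_contraction_allLipschitz L (Real.sqrt_nonneg _) (riemannLipschitz_of_linkLipschitz hF) Q Q' t β' hβ κ hreal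

/-- ★★ **Frobenius in, Frobenius out** (no smoothness): if `|F(Q') − F(Q)| ≤ K·√(Σ_e‖Q'_e − Q_e‖_F²)` with `K ≥ 0` then
`|κ_tF(Q) − κ_tF(Q')| ≤ e^(−(1−12|β'|)t)·K·(π/2)·√(Σ_e‖Q'_e − Q_e‖_F²)` (chord `≤` arc `≤ (π/2)`·chord, G41). [cite: ShenZhuZhu2022, Theorem 4.2 (4.5)] -/
theorem wilson_frobLipschitz_contraction_allLipschitz (L : ℕ) [NeZero L]
    {F : GaugeConfig 3 L (Matrix.specialUnitaryGroup (Fin 2) ℂ) → ℝ} {K : ℝ} (hK : 0 ≤ K)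
    (hF : ∀ Q Q' : GaugeConfig 3 L (Matrix.specialUnitaryGroup (Fin 2) ℂ), |F Q' - F Q| ≤ K * Real.sqrt (∑ e : Edge 3 L,
      hsForm 2 ((Q' e : Matrix (Fin 2) (Fin 2) ℂ) - (Q e : Matrix (Fin 2) (Fin 2) ℂ)) ((Q' e : Matrix (Fin 2) (Fin 2) ℂ) - (Q e : Matrix (Fin 2) (Fin 2) ℂ))))
    (Q Q' : GaugeConfig 3 L (Matrix.specialUnitaryGroup (Fin 2) ℂ)) (t : ℝ≥0) (β' : ℝ) (hβ : |β'| < 1 / 12)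
    (κ : ℝ≥0 → Kernel (GaugeConfig 3 L (Matrix.specialUnitaryGroup (Fin 2) ℂ))
      (GaugeConfig 3 L (Matrix.specialUnitaryGroup (Fin 2) ℂ))) [∀ t, IsMarkovKernel (κ t)]
    (hreal : ∀ (t : ℝ≥0) (x : GaugeConfig 3 L (Matrix.specialUnitaryGroup (Fin 2) ℂ))
        (Ω : Type) [MeasurableSpace Ω] (P : Measure Ω) [IsProbabilityMeasure P]
        (W : ℝ≥0 → Ω → (Edge 3 L × NoiseIdx 2 → ℝ)) (hW : IsFlatBrownian W P)
        (U : ℝ≥0 → Ω → GaugeConfig 3 L (Matrix.specialUnitaryGroup (Fin 2) ℂ)),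
        (∀ ω, U 0 ω = x) →
        (latticeLangevinDynamics (fundamentalLatticeRep 2) β').IsSolution (fundamentalRep (Fin 2))
          hW.natFiltration P W U →
        κ t x = P.map (U t))
    :
    |∫ y, F y ∂(κ t Q) - ∫ y, F y ∂(κ t Q')| ≤
      Real.exp (-((1 - 12 * |β'|) * (t : ℝ))) * K * (Real.pi / 2 * Real.sqrt (∑ e : Edge 3 L,
        hsForm 2 ((Q' e : Matrix (Fin 2) (Fin 2) ℂ) - (Q e : Matrix (Fin 2) (Fin 2) ℂ)) ((Q' e : Matrix (Fin 2) (Fin 2) ℂ) - (Q e : Matrix (Fin 2) (Fin 2) ℂ)))) := by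
  -- Frobenius-Lipschitz ⇒ `ρ_L`-Lipschitz with the same constant (chord ≤ arc)
  have hlip : ∀ P P' : GaugeConfig 3 L (Matrix.specialUnitaryGroup (Fin 2) ℂ), |F P' - F P| ≤ K * Real.sqrt (torusRiemannDistSq (fundamentalLatticeRep 2) P P') :=
    fun P P' => (hF P P').trans (mul_le_mul_of_nonneg_left (Real.sqrt_le_sqrt (sum_hsForm_sub_le_torusRiemannDistSq_two P P')) hK)
  have h := wilson_riemannLipschitz_contraction_allLipschitz L hK hlip Q Q' t β' hβ κ hreal
  -- arc ≤ (π/2)·chord on the output side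
  have harc : Real.sqrt (torusRiemannDistSq (fundamentalLatticeRep 2) Q Q') ≤ Real.pi / 2 * Real.sqrt (∑ e : Edge 3 L,
      hsForm 2 ((Q' e : Matrix (Fin 2) (Fin 2) ℂ) - (Q e : Matrix (Fin 2) (Fin 2) ℂ)) ((Q' e : Matrix (Fin 2) (Fin 2) ℂ) - (Q e : Matrix (Fin 2) (Fin 2) ℂ))) := by
    have h0 : 0 ≤ ∑ e : Edge 3 L, hsForm 2 ((Q' e : Matrix (Fin 2) (Fin 2) ℂ) - (Q e : Matrix (Fin 2) (Fin 2) ℂ)) ((Q' e : Matrix (Fin 2) (Fin 2) ℂ) - (Q e : Matrix (Fin 2) (Fin 2) ℂ)) :=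
      Finset.sum_nonneg fun _ _ => hsForm_self_nonneg _
    calc Real.sqrt (torusRiemannDistSq (fundamentalLatticeRep 2) Q Q') ≤ Real.sqrt (Real.pi ^ 2 / 4 * ∑ e : Edge 3 L,
          hsForm 2 ((Q' e : Matrix (Fin 2) (Fin 2) ℂ) - (Q e : Matrix (Fin 2) (Fin 2) ℂ)) ((Q' e : Matrix (Fin 2) (Fin 2) ℂ) - (Q e : Matrix (Fin 2) (Fin 2) ℂ))) :=
          Real.sqrt_le_sqrt (torusRiemannDistSq_two_le Q Q')
      _ = Real.pi / 2 * Real.sqrt (∑ e : Edge 3 L,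
          hsForm 2 ((Q' e : Matrix (Fin 2) (Fin 2) ℂ) - (Q e : Matrix (Fin 2) (Fin 2) ℂ)) ((Q' e : Matrix (Fin 2) (Fin 2) ℂ) - (Q e : Matrix (Fin 2) (Fin 2) ℂ))) := by
          rw [Real.sqrt_mul (by positivity), show Real.pi ^ 2 / 4 = (Real.pi / 2) ^ 2 by ring, Real.sqrt_sq (by positivity)]
  exact h.trans (mul_le_mul_of_nonneg_left harc (mul_nonneg (Real.exp_pos _).le hK))

/-! ## §3. Couplings of arbitrary initial laws -/

/-- ★★★ **`W₁` contraction from arbitrary initial laws, Kantorovich side.**  For `|β'| < 1/12`, every `L`, every realising kernel family `κ`, every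
`t ≥ 0`, every `ρ_L`-Lipschitz `F` (constant `L_F ≥ 0`), all probability laws `ν, ν'` of starts and EVERY coupling `π` of `(ν, ν')`:
`|∫F d(κ_t ∘ₘ ν) − ∫F d(κ_t ∘ₘ ν')| ≤ e^(−(1−12|β'|)t)·L_F·∫ ρ_L(Q,Q') dπ(Q,Q')`.  Taking the infimum over `π` and the supremum over `L_F ≤ 1`:
`W₁(νP_t, ν'P_t) ≤ e^(−(1−12|β'|)t)·W₁(ν,ν')` (Kantorovich–Rubinstein). [cite: ShenZhuZhu2022, Theorem 4.2 (4.5)] -/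
theorem wilson_W1_contraction_of_coupling (L : ℕ) [NeZero L]
    {F : GaugeConfig 3 L (Matrix.specialUnitaryGroup (Fin 2) ℂ) → ℝ} {Lf : ℝ} (hLf : 0 ≤ Lf)
    (hlip : ∀ Q Q', |F Q' - F Q| ≤ Lf * Real.sqrt (torusRiemannDistSq (fundamentalLatticeRep 2) Q Q'))
    (ν ν' : Measure (GaugeConfig 3 L (Matrix.specialUnitaryGroup (Fin 2) ℂ))) [IsProbabilityMeasure ν] [IsProbabilityMeasure ν']
    {cpl : Measure (GaugeConfig 3 L (Matrix.specialUnitaryGroup (Fin 2) ℂ) × GaugeConfig 3 L (Matrix.specialUnitaryGroup (Fin 2) ℂ))} (hπ : IsCoupling ν ν' cpl)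
    (t : ℝ≥0) (β' : ℝ) (hβ : |β'| < 1 / 12)
    (κ : ℝ≥0 → Kernel (GaugeConfig 3 L (Matrix.specialUnitaryGroup (Fin 2) ℂ))
      (GaugeConfig 3 L (Matrix.specialUnitaryGroup (Fin 2) ℂ))) [∀ t, IsMarkovKernel (κ t)]
    (hreal : ∀ (t : ℝ≥0) (x : GaugeConfig 3 L (Matrix.specialUnitaryGroup (Fin 2) ℂ))
        (Ω : Type) [MeasurableSpace Ω] (P : Measure Ω) [IsProbabilityMeasure P]
        (W : ℝ≥0 → Ω → (Edge 3 L × NoiseIdx 2 → ℝ)) (hW : IsFlatBrownian W P)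
        (U : ℝ≥0 → Ω → GaugeConfig 3 L (Matrix.specialUnitaryGroup (Fin 2) ℂ)),
        (∀ ω, U 0 ω = x) →
        (latticeLangevinDynamics (fundamentalLatticeRep 2) β').IsSolution (fundamentalRep (Fin 2))
          hW.natFiltration P W U →
        κ t x = P.map (U t))
    :
    |∫ y, F y ∂(κ t ∘ₘ ν) - ∫ y, F y ∂(κ t ∘ₘ ν')| ≤
      Real.exp (-((1 - 12 * |β'|) * (t : ℝ))) * Lf * ∫ z, Real.sqrt (torusRiemannDistSq (fundamentalLatticeRep 2) z.1 z.2) ∂cpl := by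
  haveI := borelSpace_config L
  haveI : IsProbabilityMeasure cpl := hπ.1
  haveI : IsProbabilityMeasure (κ t ∘ₘ ν) := by
    constructor; rw [Measure.bind_apply MeasurableSet.univ (κ t).measurable.aemeasurable]; simp
  haveI : IsProbabilityMeasure (κ t ∘ₘ ν') := by
    constructor; rw [Measure.bind_apply MeasurableSet.univ (κ t).measurable.aemeasurable]; simp
  have hFc : Continuous F := continuous_of_riemannLipschitz hlip
  have hκF : Continuous fun x => ∫ y, F y ∂(κ t x) := continuous_integral_transitionKernel L β' κ hreal t hFc
  -- `∫F d(κ_t∘ν) = ∫ κ_tF(z.1) dπ`, `∫F d(κ_t∘ν') = ∫ κ_tF(z.2) dπ`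
  have h1 : ∫ y, F y ∂(κ t ∘ₘ ν) = ∫ z, (∫ y, F y ∂(κ t z.1)) ∂cpl := by
    rw [Literature.Probability.Process.Harris.integral_comp_measure (κ t) ν
      (hFc.integrable_of_hasCompactSupport (HasCompactSupport.of_compactSpace F)), ← hπ.2.1, Measure.fst,
      integral_map measurable_fst.aemeasurable (hκF.aestronglyMeasurable)]
  have h2 : ∫ y, F y ∂(κ t ∘ₘ ν') = ∫ z, (∫ y, F y ∂(κ t z.2)) ∂cpl := by
    rw [Literature.Probability.Process.Harris.integral_comp_measure (κ t) ν'
      (hFc.integrable_of_hasCompactSupport (HasCompactSupport.of_compactSpace F)), ← hπ.2.2, Measure.snd,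
      integral_map measurable_snd.aemeasurable (hκF.aestronglyMeasurable)]
  have hi1 : Integrable (fun z : GaugeConfig 3 L (Matrix.specialUnitaryGroup (Fin 2) ℂ) × GaugeConfig 3 L (Matrix.specialUnitaryGroup (Fin 2) ℂ) =>
      ∫ y, F y ∂(κ t z.1)) cpl := (hκF.comp continuous_fst).integrable_of_hasCompactSupport (HasCompactSupport.of_compactSpace _)
  have hi2 : Integrable (fun z : GaugeConfig 3 L (Matrix.specialUnitaryGroup (Fin 2) ℂ) × GaugeConfig 3 L (Matrix.specialUnitaryGroup (Fin 2) ℂ) =>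
      ∫ y, F y ∂(κ t z.2)) cpl := (hκF.comp continuous_snd).integrable_of_hasCompactSupport (HasCompactSupport.of_compactSpace _)
  have hρc : Continuous fun z : GaugeConfig 3 L (Matrix.specialUnitaryGroup (Fin 2) ℂ) × GaugeConfig 3 L (Matrix.specialUnitaryGroup (Fin 2) ℂ) =>
      Real.sqrt (torusRiemannDistSq (fundamentalLatticeRep 2) z.1 z.2) := Real.continuous_sqrt.comp continuous_torusRiemannDistSq_two
  have hρi : Integrable (fun z : GaugeConfig 3 L (Matrix.specialUnitaryGroup (Fin 2) ℂ) × GaugeConfig 3 L (Matrix.specialUnitaryGroup (Fin 2) ℂ) =>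
      Real.sqrt (torusRiemannDistSq (fundamentalLatticeRep 2) z.1 z.2)) cpl := hρc.integrable_of_hasCompactSupport (HasCompactSupport.of_compactSpace _)
  rw [h1, h2, ← integral_sub hi1 hi2]
  have hpt : ∀ z : GaugeConfig 3 L (Matrix.specialUnitaryGroup (Fin 2) ℂ) × GaugeConfig 3 L (Matrix.specialUnitaryGroup (Fin 2) ℂ),
      |(∫ y, F y ∂(κ t z.1)) - ∫ y, F y ∂(κ t z.2)| ≤
        Real.exp (-((1 - 12 * |β'|) * (t : ℝ))) * Lf * Real.sqrt (torusRiemannDistSq (fundamentalLatticeRep 2) z.1 z.2) := fun z =>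
    wilson_riemannLipschitz_contraction_allLipschitz L hLf hlip z.1 z.2 t β' hβ κ hreal
  calc |∫ z, ((∫ y, F y ∂(κ t z.1)) - ∫ y, F y ∂(κ t z.2)) ∂cpl| ≤ ∫ z, |(∫ y, F y ∂(κ t z.1)) - ∫ y, F y ∂(κ t z.2)| ∂cpl := abs_integral_le_integral_abs
    _ ≤ ∫ z, Real.exp (-((1 - 12 * |β'|) * (t : ℝ))) * Lf * Real.sqrt (torusRiemannDistSq (fundamentalLatticeRep 2) z.1 z.2) ∂cpl :=
        integral_mono_of_nonneg (ae_of_all _ fun _ => abs_nonneg _) (hρi.const_mul _) (ae_of_all _ hpt)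
    _ = Real.exp (-((1 - 12 * |β'|) * (t : ℝ))) * Lf * ∫ z, Real.sqrt (torusRiemannDistSq (fundamentalLatticeRep 2) z.1 z.2) ∂cpl :=
        integral_const_mul _ _

/-- ★★ **`W₁` contraction from arbitrary initial laws, against the coupling infimum.**  With the tree's `szzWassersteinSq c ν ν' = inf_π ∫ c dπ` taken
for the UN-squared cost `c = ρ_L` (so that it is `W₁(ν,ν')`): `ofReal |∫F d(κ_t ∘ₘ ν) − ∫F d(κ_t ∘ₘ ν')| ≤ ofReal(e^(−(1−12|β'|)t)·L_F) · W₁(ν,ν')`.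
[cite: ShenZhuZhu2022, Theorem 4.2 (4.5)] -/
theorem wilson_W1_contraction_szzWasserstein (L : ℕ) [NeZero L]
    {F : GaugeConfig 3 L (Matrix.specialUnitaryGroup (Fin 2) ℂ) → ℝ} {Lf : ℝ} (hLf : 0 ≤ Lf)
    (hlip : ∀ Q Q', |F Q' - F Q| ≤ Lf * Real.sqrt (torusRiemannDistSq (fundamentalLatticeRep 2) Q Q'))
    (ν ν' : Measure (GaugeConfig 3 L (Matrix.specialUnitaryGroup (Fin 2) ℂ))) [IsProbabilityMeasure ν] [IsProbabilityMeasure ν']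
    (t : ℝ≥0) (β' : ℝ) (hβ : |β'| < 1 / 12)
    (κ : ℝ≥0 → Kernel (GaugeConfig 3 L (Matrix.specialUnitaryGroup (Fin 2) ℂ))
      (GaugeConfig 3 L (Matrix.specialUnitaryGroup (Fin 2) ℂ))) [∀ t, IsMarkovKernel (κ t)]
    (hreal : ∀ (t : ℝ≥0) (x : GaugeConfig 3 L (Matrix.specialUnitaryGroup (Fin 2) ℂ))
        (Ω : Type) [MeasurableSpace Ω] (P : Measure Ω) [IsProbabilityMeasure P]
        (W : ℝ≥0 → Ω → (Edge 3 L × NoiseIdx 2 → ℝ)) (hW : IsFlatBrownian W P)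
        (U : ℝ≥0 → Ω → GaugeConfig 3 L (Matrix.specialUnitaryGroup (Fin 2) ℂ)),
        (∀ ω, U 0 ω = x) →
        (latticeLangevinDynamics (fundamentalLatticeRep 2) β').IsSolution (fundamentalRep (Fin 2))
          hW.natFiltration P W U →
        κ t x = P.map (U t))
    :
    ENNReal.ofReal |∫ y, F y ∂(κ t ∘ₘ ν) - ∫ y, F y ∂(κ t ∘ₘ ν')| ≤
      ENNReal.ofReal (Real.exp (-((1 - 12 * |β'|) * (t : ℝ))) * Lf) *
        szzWassersteinSq (fun U U' : GaugeConfig 3 L (Matrix.specialUnitaryGroup (Fin 2) ℂ) => Real.sqrt (torusRiemannDistSq (fundamentalLatticeRep 2) U U')) ν ν' := by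
  haveI := borelSpace_config L
  set c : ℝ := Real.exp (-((1 - 12 * |β'|) * (t : ℝ))) * Lf with hc
  have hc0 : 0 ≤ c := mul_nonneg (Real.exp_pos _).le hLf
  rcases hc0.eq_or_lt with hc00 | hcpos
  · -- `L_F = 0`: `F` is constant and both sides vanish
    have hLf0 : Lf = 0 := by
      rcases mul_eq_zero.1 hc00.symm with h | h
      · exact absurd h (Real.exp_pos _).ne'
      · exact h
    have hconst : ∀ Q Q', F Q' = F Q := fun Q Q' => by
      have := hlip Q Q'; rw [hLf0, zero_mul] at this; exact eq_of_abs_sub_nonpos this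
    have hFconst : F = fun _ => F (fun _ => 1) := funext fun Q => hconst _ _
    haveI : IsProbabilityMeasure (κ t ∘ₘ ν) := by
      constructor; rw [Measure.bind_apply MeasurableSet.univ (κ t).measurable.aemeasurable]; simp
    haveI : IsProbabilityMeasure (κ t ∘ₘ ν') := by
      constructor; rw [Measure.bind_apply MeasurableSet.univ (κ t).measurable.aemeasurable]; simp
    rw [hFconst]
    simp
  · unfold szzWassersteinSq
    rw [ENNReal.mul_iInf_of_ne (ENNReal.ofReal_pos.2 hcpos).ne' ENNReal.ofReal_ne_top]
    refine le_iInf fun q => ?_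
    haveI := q.2.1
    have hρc : Continuous fun z : GaugeConfig 3 L (Matrix.specialUnitaryGroup (Fin 2) ℂ) × GaugeConfig 3 L (Matrix.specialUnitaryGroup (Fin 2) ℂ) =>
        Real.sqrt (torusRiemannDistSq (fundamentalLatticeRep 2) z.1 z.2) := Real.continuous_sqrt.comp continuous_torusRiemannDistSq_two
    have hρi : Integrable (fun z : GaugeConfig 3 L (Matrix.specialUnitaryGroup (Fin 2) ℂ) × GaugeConfig 3 L (Matrix.specialUnitaryGroup (Fin 2) ℂ) =>
        Real.sqrt (torusRiemannDistSq (fundamentalLatticeRep 2) z.1 z.2)) (q : Measure _) :=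
      hρc.integrable_of_hasCompactSupport (HasCompactSupport.of_compactSpace _)
    have h := wilson_W1_contraction_of_coupling L hLf hlip ν ν' q.2 t β' hβ κ hreal
    rw [← ofReal_integral_eq_lintegral_ofReal hρi (ae_of_all _ fun _ => Real.sqrt_nonneg _), ← ENNReal.ofReal_mul hc0]
    exact ENNReal.ofReal_le_ofReal h

end Summit.QuantumFields.YangMills.Theorems.ColdStartUniversality

end
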